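import Summits.AtomisticToContinuum.Crystallization.Theorems.FrustratedLawDichotomyCellTflatClassesA
import Summits.AtomisticToContinuum.Crystallization.Theorems.FrustratedLawDichotomyCellTflatClassesB
import Summits.AtomisticToContinuum.Crystallization.Theorems.FrustratedLawDichotomyCellTflatClassesC
import Summits.AtomisticToContinuum.Crystallization.Theorems.FrustratedLawDichotomyCellTflatClassesD

/-!
# FrustratedLawDichotomy · crux `AperiodicFrustratedLawGap` (stmt-AtomisticToContinuum-27623) — ★★ THE T′♭₄₅ LITERAL OF RECORD IS FALSE:
# `∀ C_T, ¬ SchurTopologicalPricing (1/20) (1/8) w₄₅ ω₄ (3/400) (−7175/10000) (1/100) C_T`, and more generally for every `κ_T ≥ 0.994·10⁻²`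
# (decomp-a2c, prover hand 1, generation 15; critic rows 543 (B3)(2) / 555 (B) / 564 (i); axioms standard — sixteen `decide +kernel` class evaluations)

THE WITNESS (`…CellTflatData.cellT`): an all-strained hcp 2×2×2 periodic cell found this generation by optimising the CERTIFIABLE flag directly — every site
has radial spread `r₁₂/d = 1.1254 ≥ 9/8` (so, by the rotation-free radial obstruction `…CellKitF.not_goodAt_of_radial`, it is NOT `1/8`-good and NOT
`1/20`-good for ANY isometry and ANY assignment), a clean twelve-shell, separation `≥ 0.93`, and mean priced `W₄₅` site energy `−0.7175 + 0.99376·10⁻²`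
(certified upper bound from `…CellKitW.effPot_le_ubW` termwise; num/certify-style exact mirror).  Hand-1 g14's T-ceiling was `1.3128·10⁻²` (misfit-based
adversary); the `E₂g` optical basal-slip basin found here is cheaper by `3.2·10⁻³` per site and crosses the literal `κ_T = 1/100`.
THE THEOREMS: `cellT_checkClass`, ★ `not_schurTopologicalPricing_fourHalf_of_ge` (`994/10⁵ ≤ κ_T`), ★★ `not_schurTopologicalPricing_fourHalf_centi`
(`κ_T = 1/100`, every `C_T`) — through `…CellCheckerBad.not_schurTopologicalPricing_fourHalf_of_checkBad` and the all-bad twin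
`…PeriodicBlockViolationBad.not_schurTopologicalPricing_of_badCell` of hand-2 g15's periodic-block negative kernel.
CONSEQUENCE for the column of record: every door taking `hT : SchurTopologicalPricing (1/20) (1/8) w₄₅ ω₄ (3/400) (−7175/10000) (1/100) C_T`
(`…SchurCutB.fdg_of_split_schurCut_fourHalf'`-type kernels, `…PeriodicEnergyCeiling`, `…SchurMotifFourHalfProved`, `…OptimalityCut`, `…AveragingCut*`)
has an UNSATISFIABLE hypothesis at that literal; the T-price must be re-filed below `0.994·10⁻²` (and the true infimum over periodic all-bad cells may be lower
still — this is ONE basin of a 16-atom cell).  All `[folklore]`; 0 sorry; no `native_decide`.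
-/

namespace Summit.AtomisticToContinuum.Crystallization.Theorems.FrustratedLawDichotomyCellTflatCeiling

open Summit.AtomisticToContinuum.Crystallization.Theorems.FrustratedLawDichotomySchurCut
open Summit.AtomisticToContinuum.Crystallization.Theorems.FrustratedLawDichotomyCellChecker

/-- All sixteen classes of `cellT` pass `checkClassBad`. [folklore] -/
theorem cellT_checkClass : ∀ m : Fin cellT.N₀, cellT.checkClassBad m (cellTCert m) = true := by
  intro m
  obtain ⟨m, hm⟩ := m
  have hm' : m < 16 := hm
  interval_cases m
  exacts [cellT_checkClass0, cellT_checkClass1, cellT_checkClass2, cellT_checkClass3, cellT_checkClass4, cellT_checkClass5, cellT_checkClass6, cellT_checkClass7, cellT_checkClass8, cellT_checkClass9, cellT_checkClass10, cellT_checkClass11, cellT_checkClass12, cellT_checkClass13, cellT_checkClass14, cellT_checkClass15]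

/-- ★ **T′♭₄₅ ceiling**: for every `κ_T ≥ 994/10⁵` and every `C_T`, `¬ SchurTopologicalPricing (1/20) (1/8) w₄₅ ω₄ (3/400) (−7175/10000) κ_T C_T`. [folklore] -/
theorem not_schurTopologicalPricing_fourHalf_of_ge {κT : ℝ} (hκ : (994 : ℝ) / 10 ^ 5 ≤ κT) (CT : ℝ) :
    ¬ SchurTopologicalPricing (1 / 20) (1 / 8) w₄₅ ω₄ (3 / 400) (-(7175 / 10000)) κT CT := by
  refine cellT.not_schurTopologicalPricing_fourHalf_of_checkBad cellTCert cellT_checkGeom cellT_checkClass ?_ CT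
  have hN : ((cellT.N₀ : ℕ) : ℝ) = 16 := by norm_num [cellT]
  rw [hN]
  calc _ < (((16 * (-(7175 / 10000) + 994 / 10 ^ 5) : ℚ)) : ℝ) := (Rat.cast_lt (K := ℝ)).2 cellT_total
    _ ≤ 16 * (-(7175 / 10000) + _) := by push_cast; nlinarith

/-- ★★ **THE T′♭₄₅ LITERAL OF RECORD (`κ_T = 1/100`) IS FALSE for every `C_T`.** [folklore] -/
theorem not_schurTopologicalPricing_fourHalf_centi (CT : ℝ) :
    ¬ SchurTopologicalPricing (1 / 20) (1 / 8) w₄₅ ω₄ (3 / 400) (-(7175 / 10000)) (1 / 100) CT :=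
  not_schurTopologicalPricing_fourHalf_of_ge (by norm_num) CT

end Summit.AtomisticToContinuum.Crystallization.Theorems.FrustratedLawDichotomyCellTflatCeiling
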